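import Literature.MathematicalPhysics.QuantumFieldTheory.Balaban1983to89.B15Prop1CriticalChartFromIFT
import Literature.MathematicalPhysics.QuantumFieldTheory.Balaban1983to89.B15DeterminingSetsB

/-!
# `Balaban1983to89.B15Prop1CriticalChartFromIFT` — [Balaban1985Variational] = «[15]», Thm 1 p. 279 («a unique critical orbit in the space (6)»), Sect. G pp. 305–309, Prop. 9 (190) — **BOND-DATUM EDITION** (`…B15Prop1CriticalChartFromIFTB`, USED DECLARATIONS ONLY): the print-datum ([Balaban1984PropagatorsII] (2.3)) twins of the declarations of `B15Prop1CriticalChartFromIFT` that N12's junction of record v14ᴸ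
uses with a datum-bearing statement (`exists_localChart_of_criticalFamily_local`) — class (γ) of dag-n12-c's census-by-declaration v2 (bus [DAGN12C-G35], 2026-08-30).  GENERATOR (block-extracted from the
parent's tree bytes by HOME `lean/g35/gen/gen_blocks.py`): namespace `…B`, SAME names, `DetSet ↦ BDetSet` (F0a), `AgreeOn ↦ AgreeOnB`, `IsMinimizer ↦ IsMinimizerB`, `bondsOf (𝐁 j) ↦ 𝔅 j`, `constrCard ∕
constrEnum ∕ ConstrSet ∕ msChart ↦ …B` (lane `Node00/MultiScaleFibreChartB`), `IsCritOnFibre ∕ IsFibreChartNear ↦ …B`; proofs VERBATIM; the parent's other (datum-free) declarations REUSED by `open`.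

statement-level skeleton of published theorems with citation tags; proofs where landed; nothing here is a claim about
the Yang–Mills mass gap

Cell `pub-ymgap` (HUMAN RULINGS D-0062 ∕ D-0149), lane `pub-ymgap-dag-n12-c` g35 (R134 seat (a), N12 = [B15], s1, lane owner); `--kind proof --supports` K1⁹ `stmt-QuantumFields-27364`; count-neutral.
THEOREMS ONLY (0 `def`, 0 `instance`, 0 `sorry`).  HONESTY GUARD (director-ym №338 (5)): PURELY ADDITIVE — the parent stays landed and true on its own text; nothing in it is edited; no displayed
premise of any consumer is deleted or weakened; every hypothesis stays a hypothesis.  Nothing of Bałaban's analysis asserted; N12 NOT discharged; K0⁷ ∕ K1⁹ NOT closed; one finite 𝕋⁴ programme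
at fixed ε — nothing continuum ∕ ℝ⁴ ∕ OS; the Yang–Mills mass gap (Clay) is NOT proved by any of this.

PARENT's DOCSTRING (mathematics and citations; read `𝐁` as the bond datum `𝔅`):
# `Balaban1983to89.B15Prop1CriticalChartFromIFT` — [Balaban1985Variational] = «[15]», Thm 1 p. 279 («a unique critical orbit in the space (6)»), Sect. G pp. 305–309, Prop. 9 (190)
# p. 309; [Balaban1989LargeFieldI] = «[IV]», Prop. 1 p. 194 (last clause); [Balaban1988Convergent] = «[III]», (2.12) p. 256:
# A LOCAL HOLOMORPHIC CHART OF (2.12) MINIMISERS ON THE LEVEL-0 COMPLEX CONFIGURATION SPACE FROM THE COMPLEX IMPLICIT-FUNCTION THEOREM — the hypothesis `hloc` of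
# `B15Prop1MinimiserFamilyPatching.hMin_of_localCharts`, from a nondegenerate conjugation-symmetric complex Lagrange system in coordinates

Honest framing: statement-level skeleton of published theorems with citation tags; proofs where landed; nothing here is a claim about the
Yang–Mills mass gap.  Cell `pub-ymgap`, HUMAN RULING D-0149 (width seats), seat `pub-ymgap-dag-n12-w1` (g2; N12 = [B15]; U1a⁺ of the w1 lineage, U1A-CENSUS §4 item 1 (δ′));
count-neutral; N12 NOT discharged; finite 𝕋⁴ at fixed ε; nothing continuum ∕ OS ∕ mass-gap ∕ Clay.

WHY.  `hMin_of_localCharts` (this seat, `B15Prop1MinimiserFamilyPatching`) reduces the intrinsic analytic letter (J0′) of the N12∕s1 endpoints to LOCAL CHARTS: at every base field an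
open set `O` of level-0 complex configurations `Q` containing the base datum and a map `Γ` with entries ℂ-differentiable on `O`, bounded on `O`, which at every REAL `Q ∈ O` IS an
`SU(2)` configuration minimal for the (2.12) problem of the datum `M˙(Q)`.  Print obtains the analytic extension of `U_k(V)` in the axial gauge ([15] Sect. G, Prop. 9) from the
equations of the variational problem, which «are valid for Gᶜ-valued fields» (p. 307), and identifies its real values with THE minimiser through Thm 1's clause «this orbit is a
unique critical orbit in the space (6)».  THIS MODULE types that passage ABSTRACTLY IN COORDINATES: a complex coordinate space `E` (states) and `F` (constraint values) with
conjugations, a state chart `χ : E → (bond ↦ M₂(ℂ))` intertwining conjugation with the unitary real structure `θ(A) = (A⋆)⁻¹` and valued in `det = 1`, a ℂ-analytic action `a`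
and constraint `Φ` on `E` (equivariant), datum coordinates `κ` on the configuration space — and the complex Lagrange system at a REAL, ONTO, NONDEGENERATE constrained critical
base state `x₀`.  Then `Γ := χ ∘ γ ∘ κ` with `γ` the implicit critical family (`ConstrainedCriticalFamily.exists_criticalFamily_tangent_real`: holomorphic, fibre-wise critical in
the tangent form, REAL ON REAL) is such a chart, GIVEN the three transfers to NODE 00's predicates near the base point — (class) `χ x ∈ reg`, (fibre) `Φ x = κ Q ⇒ Ū(χ x) = Ū(Q)` on
`𝔹`, (critical) tangent-form criticality in coordinates ⇒ a criticality predicate `Crit` — and [15] Thm 1's uniqueness clause «in the class, on the fibre, critical ⇒ minimal» for the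
data near the base datum (DISPLAYED: `hT1u`).  The N12 instantiation (`E` = the complexified exponential chart at a minimiser with the gauge condition adjoined to `Φ`, `κ` = the
holomorphic logarithmic coordinates of the averages `iterMh` of this seat's g0 files, `a` = the trace-polynomial Wilson action) is the successor module; every hypothesis below is
shaped for it.

CONTENTS (theorems only; no `def`, no `instance`, no `sorry`).  §1 `mem_specialUnitaryGroup_of_theta_fixed` (`A = (A⋆)⁻¹`, `det A = 1` ⇒ `A ∈ SU(2)`), `norm_entry_le_one_of_theta_fixed`,
`differentiable_entry`.  §2 ★★★ `exists_localChart_of_criticalFamily` (the chart `(O, Γ)` with the three clauses of `hloc`, from the complex IFT data + transfers + `hT1u`).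
§3 `cplxVec_zero`, `datumC_coeField_zero`, ★★★ `hMin_of_criticalFamilies` — §2 at every base field `V_k` of a compact `K` (a FAMILY of complex Lagrange systems in fixed coordinate spaces
`E`, `F`, indexed by `V_k`) fed into `B15Prop1MinimiserFamilyPatching.hMin_of_localCharts`: the letter (J0′) `hMin` of p586362 ∕ p589595 with ONE radius `R`, for the chart
family `Q_k^{s*}(exp(iB′)·ext(exp(ip)V_k))` of [IV] Prop. 1 under `hext`.
HONEST SCOPE: generic calculus ∕ topology around part II of `ConstrainedCriticalFamily`; the transfers, the nondegeneracy (β), «DΦ onto» and [15] Thm 1's clause are DISPLAYED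
hypotheses; nothing of Bałaban's is asserted.
-/


noncomputable section

namespace Literature.MathematicalPhysics.QuantumFieldTheory.Balaban1983to89.B15Prop1CriticalChartFromIFTB

open B15Prop1CriticalChartFromIFT


open Set Metric Filter
open scoped Topology ContDiff ComplexConjugate
open Literature.Analysis.Calculus.ConstrainedCriticalFamily (exists_criticalFamily_real)
open Literature.MathematicalPhysics.QuantumFieldTheory.Balaban1983to89.Node00 (SU coeField coeField_apply)
open B15ComplexifiedDatumFamily (datumC datumC_real)
open B15Prop1MinimiserFamilyPatching (hMin_of_localCharts)
open Literature.MathematicalPhysics.QuantumFieldTheory.BalabanImbrieJaffe1984to88.BIJ85Eq453GaugeField (qsstarGIter0)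
open B15Prop1AnalyticExtClause (cplxVec)
open B15Prop1ChartCalculusSU2 (E3)
open B15Prop1ChartSU2 (su2Chart)
open B15ShellGauge193 (shellGauge)
open B15Extension193 (extend)
open B16Sect1Backgrounds (expMul expMul_zero)
open T4CubeChartGnomonic (SU2)
open T4Continuum B15DeterminingSets B15DeterminingSetsB GaugeField
open scoped Matrix.Norms.L2Operator



section
variable {P : Params}
  {E : Type*} [NormedAddCommGroup E] [NormedSpace ℂ E] [FiniteDimensional ℂ E]
  {F : Type*} [NormedAddCommGroup F] [NormedSpace ℂ F] [FiniteDimensional ℂ F]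

/-- ★★★ **A LOCAL HOLOMORPHIC CHART OF (2.12) MINIMISERS FROM THE COMPLEX IMPLICIT-FUNCTION THEOREM — LOCALISED TRANSFERS.**  As `exists_localChart_of_criticalFamily`, with the transfer
hypothesis asked only for pairs `(x, Q)` near `(x₀, ↑Q₀)`: «`χ x = ↑U′`, `↑Q′ = Q`, `Φ x = κ Q`, `Da(x) = μ ∘ DΦ(x)` with `μ` real ⇒ `U′ ∈ reg ∧ Ū(U′) = Ū(Q′) on 𝔅 ∧ Crit Q′ U′`» — the form the
N12 datum coordinates supply (`B15Prop1DatumCoordinates.eventually_agreeOn_of_datumCoord_eq`). [cite: Balaban1985Variational, Thm 1 p.279, Sect. G pp.305–307, (181) p.307, Prop. 9 (190) p.309; Balaban1989LargeFieldI, Prop. 1 p.194 (last clause); Balaban1988Convergent, (2.12) p.256; LuenbergerYe2008, §10.7 pp.306–307] -/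
theorem exists_localChart_of_criticalFamily_local (av : ∀ j, Averaging P j SU2) (reg : Set (GaugeField P 0 SU2)) (𝔅 : BDetSet P)
    (cE : E →L⋆[ℂ] E) (cF : F →L⋆[ℂ] F) (hcE : ∀ x, cE (cE x) = x) (hcF : ∀ y, cF (cF y) = y)
    {a : E → ℂ} {Φ : E → F} {x₀ : E} {ℓ₀ : F →L[ℂ] ℂ} {m : WithTop ℕ∞} (hm : m ≠ 0) (hm' : m ≠ (⊤ : ℕ∞))
    (ha : ContDiffAt ℂ (m + 1) a x₀) (hΦ : ContDiffAt ℂ (m + 1) Φ x₀)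
    (hcrit : fderiv ℂ a x₀ = ℓ₀.comp (fderiv ℂ Φ x₀))
    (honto : Function.Surjective (fderiv ℂ Φ x₀))
    (hnondeg : ∀ s : E, fderiv ℂ Φ x₀ s = 0 →
      (∀ t : E, fderiv ℂ Φ x₀ t = 0 → fderiv ℂ (fderiv ℂ a) x₀ s t - ℓ₀ (fderiv ℂ (fderiv ℂ Φ) x₀ s t) = 0) → s = 0)
    (haE : ∀ x, a (cE x) = conj (a x)) (hΦE : ∀ x, Φ (cE x) = cF (Φ x)) (hx₀ : cE x₀ = x₀)
    (χ : E → PBond P 0 → Matrix (Fin 2) (Fin 2) ℂ) (hχ : ∀ᶠ x in 𝓝 x₀, DifferentiableAt ℂ χ x)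
    (hχθ : ∀ x b, χ (cE x) b = (star (χ x b))⁻¹) (hχdet : ∀ x b, (χ x b).det = 1)
    (κ : (PBond P 0 → Matrix (Fin 2) (Fin 2) ℂ) → F) {Q₀ : GaugeField P 0 SU2} (hκ₀ : κ (coeField Q₀) = Φ x₀)
    (hκ : ∀ᶠ Q in 𝓝 (coeField Q₀), DifferentiableAt ℂ κ Q)
    (hκreal : ∀ᶠ Q in 𝓝 (coeField Q₀), ∀ Q' : GaugeField P 0 SU2, coeField Q' = Q → cF (κ Q) = κ Q)
    (Crit : GaugeField P 0 SU2 → GaugeField P 0 SU2 → Prop)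
    -- the transfers, LOCALISED in the pair (state, datum)
    (htransfer : ∀ᶠ w in 𝓝 (x₀, coeField Q₀), ∀ (U' Q' : GaugeField P 0 SU2) (μ : F →L[ℂ] ℂ), χ w.1 = coeField U' → coeField Q' = w.2 →
      Φ w.1 = κ w.2 → fderiv ℂ a w.1 = μ.comp (fderiv ℂ Φ w.1) → (starL ℂ : ℂ ≃L⋆[ℂ] ℂ).toContinuousLinearMap.comp (μ.comp cF) = μ →
        U' ∈ reg ∧ AgreeOnB 𝔅 (avgFamily av U') (avgFamily av Q') ∧ Crit Q' U')
    (hT1u : ∀ᶠ Q in 𝓝 (coeField Q₀), ∀ U' Q' : GaugeField P 0 SU2, coeField Q' = Q →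
      U' ∈ reg → AgreeOnB 𝔅 (avgFamily av U') (avgFamily av Q') → Crit Q' U' → IsMinimizerB av reg 𝔅 (avgFamily av Q') U')
    {𝓐₀ : ℝ} (h𝓐₀ : 1 < 𝓐₀) :
    ∃ O : Set (PBond P 0 → Matrix (Fin 2) (Fin 2) ℂ), IsOpen O ∧ coeField Q₀ ∈ O ∧
      ∃ Γ : (PBond P 0 → Matrix (Fin 2) (Fin 2) ℂ) → PBond P 0 → Matrix (Fin 2) (Fin 2) ℂ,
        (∀ b i j, DifferentiableOn ℂ (fun Q => Γ Q b i j) O) ∧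
        (∀ Q ∈ O, ∀ b i j, ‖Γ Q b i j‖ ≤ 𝓐₀) ∧
        ∀ Q' : GaugeField P 0 SU2, coeField Q' ∈ O →
          ∃ U' : GaugeField P 0 SU2, (∀ b, Γ (coeField Q') b = ((U' b : SU2) : Matrix (Fin 2) (Fin 2) ℂ)) ∧
            IsMinimizerB av reg 𝔅 (avgFamily av Q') U' := by
  -- the implicit critical family, real on real (with its multipliers)
  obtain ⟨γ, Λ, -, hγ0, -, hγc, -, hid, -, -, -, hreal⟩ :=
    exists_criticalFamily_real hm ha hΦ hcrit honto hnondeg cE cF hcE hcF haE hΦE hx₀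
  have hγ : ∀ᶠ g in 𝓝 (Φ x₀), Φ (γ g) = g ∧ ContDiffAt ℂ m γ g ∧
      fderiv ℂ a (γ g) = (Λ g).comp (fderiv ℂ Φ (γ g)) ∧
      (cF g = g → cE (γ g) = γ g ∧ (starL ℂ : ℂ ≃L⋆[ℂ] ℂ).toContinuousLinearMap.comp ((Λ g).comp cF) = Λ g) := by
    filter_upwards [hid, hγc.eventually hm', hreal] with g hg hcg hrg
    exact ⟨hg.1, hcg, hg.2, hrg⟩
  have hγt : Tendsto γ (𝓝 (Φ x₀)) (𝓝 x₀) := by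
    have h := hγc.continuousAt.tendsto
    rwa [hγ0] at h
  have hG : ∀ᶠ g in 𝓝 (Φ x₀), (Φ (γ g) = g ∧ ContDiffAt ℂ m γ g ∧
      fderiv ℂ a (γ g) = (Λ g).comp (fderiv ℂ Φ (γ g)) ∧
      (cF g = g → cE (γ g) = γ g ∧ (starL ℂ : ℂ ≃L⋆[ℂ] ℂ).toContinuousLinearMap.comp ((Λ g).comp cF) = Λ g)) ∧
      DifferentiableAt ℂ χ (γ g) := hγ.and (hγt.eventually hχ)
  have hκt : Tendsto κ (𝓝 (coeField Q₀)) (𝓝 (Φ x₀)) := by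
    have h := hκ.self_of_nhds.continuousAt.tendsto
    rwa [hκ₀] at h
  -- the pair `(γ (κ Q), Q)` tends to `(x₀, ↑Q₀)`: pull the localised transfer back to `Q`
  have hpair : Tendsto (fun Q => (γ (κ Q), Q)) (𝓝 (coeField Q₀)) (𝓝 (x₀, coeField Q₀)) :=
    (hγt.comp hκt).prodMk_nhds tendsto_id
  have htrQ : ∀ᶠ Q in 𝓝 (coeField Q₀), ∀ (U' Q' : GaugeField P 0 SU2) (μ : F →L[ℂ] ℂ), χ (γ (κ Q)) = coeField U' → coeField Q' = Q →
      Φ (γ (κ Q)) = κ Q → fderiv ℂ a (γ (κ Q)) = μ.comp (fderiv ℂ Φ (γ (κ Q))) →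
        (starL ℂ : ℂ ≃L⋆[ℂ] ℂ).toContinuousLinearMap.comp (μ.comp cF) = μ →
          U' ∈ reg ∧ AgreeOnB 𝔅 (avgFamily av U') (avgFamily av Q') ∧ Crit Q' U' :=
    hpair.eventually htransfer
  -- continuity of `Γ = χ ∘ γ ∘ κ` at the base datum and the entry bound there
  have hΓc : ContinuousAt (fun Q => χ (γ (κ Q))) (coeField Q₀) := by
    have h1 : ContinuousAt χ (γ (κ (coeField Q₀))) := by
      rw [hκ₀, hγ0]; exact hχ.self_of_nhds.continuousAt
    have h2 : ContinuousAt γ (κ (coeField Q₀)) := by rw [hκ₀]; exact hγc.continuousAt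
    have h3 : ContinuousAt (fun Q => γ (κ Q)) (coeField Q₀) := h2.comp hκ.self_of_nhds.continuousAt
    exact ContinuousAt.comp (f := fun Q => γ (κ Q)) h1 h3
  have hbase : ∀ b i j, ‖χ (γ (κ (coeField Q₀))) b i j‖ < 𝓐₀ := fun b i j => by
    rw [hκ₀, hγ0]
    have hθ : χ x₀ b = (star (χ x₀ b))⁻¹ := by
      have h := hχθ x₀ b
      rwa [hx₀] at h
    exact lt_of_le_of_lt (norm_entry_le_one_of_theta_fixed hθ (hχdet x₀ b) i j) h𝓐₀
  have hbound : ∀ᶠ Q in 𝓝 (coeField Q₀), ∀ b i j, ‖χ (γ (κ Q)) b i j‖ < 𝓐₀ := by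
    refine eventually_all.2 fun b => eventually_all.2 fun i => eventually_all.2 fun j => ?_
    have hc : ContinuousAt (fun Q => ‖χ (γ (κ Q)) b i j‖) (coeField Q₀) :=
      ((continuous_apply j).continuousAt.comp ((continuous_apply i).continuousAt.comp
        ((continuous_apply b).continuousAt.comp hΓc))).norm
    exact hc.eventually (gt_mem_nhds (hbase b i j))
  -- the good set of data and the open chart domain
  have hS : ∀ᶠ Q in 𝓝 (coeField Q₀), DifferentiableAt ℂ κ Q ∧ (∀ b i j, ‖χ (γ (κ Q)) b i j‖ < 𝓐₀) ∧
      (∀ Q' : GaugeField P 0 SU2, coeField Q' = Q → cF (κ Q) = κ Q) ∧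
      (∀ U' Q' : GaugeField P 0 SU2, coeField Q' = Q →
        U' ∈ reg → AgreeOnB 𝔅 (avgFamily av U') (avgFamily av Q') → Crit Q' U' → IsMinimizerB av reg 𝔅 (avgFamily av Q') U') ∧
      ((Φ (γ (κ Q)) = κ Q ∧ ContDiffAt ℂ m γ (κ Q) ∧
        fderiv ℂ a (γ (κ Q)) = (Λ (κ Q)).comp (fderiv ℂ Φ (γ (κ Q))) ∧
        (cF (κ Q) = κ Q → cE (γ (κ Q)) = γ (κ Q) ∧
          (starL ℂ : ℂ ≃L⋆[ℂ] ℂ).toContinuousLinearMap.comp ((Λ (κ Q)).comp cF) = Λ (κ Q))) ∧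
        DifferentiableAt ℂ χ (γ (κ Q))) ∧
      (∀ (U' Q' : GaugeField P 0 SU2) (μ : F →L[ℂ] ℂ), χ (γ (κ Q)) = coeField U' → coeField Q' = Q →
        Φ (γ (κ Q)) = κ Q → fderiv ℂ a (γ (κ Q)) = μ.comp (fderiv ℂ Φ (γ (κ Q))) →
          (starL ℂ : ℂ ≃L⋆[ℂ] ℂ).toContinuousLinearMap.comp (μ.comp cF) = μ →
            U' ∈ reg ∧ AgreeOnB 𝔅 (avgFamily av U') (avgFamily av Q') ∧ Crit Q' U') :=
    hκ.and (hbound.and (hκreal.and (hT1u.and ((hκt.eventually hG).and htrQ))))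
  obtain ⟨S, hSsub, hSopen, hSmem⟩ := _root_.mem_nhds_iff.1 hS
  refine ⟨S, hSopen, hSmem, fun Q => χ (γ (κ Q)), fun b i j => ?_, fun Q hQ b i j => le_of_lt ((hSsub hQ).2.1 b i j), fun Q' hQ' => ?_⟩
  · intro Q hQ
    obtain ⟨hκQ, -, -, -, ⟨⟨-, hγQ, -, -⟩, hχQ⟩, -⟩ := hSsub hQ
    have h : DifferentiableAt ℂ (fun Q => χ (γ (κ Q))) Q := hχQ.comp Q ((hγQ.differentiableAt hm).comp Q hκQ)
    have hb : DifferentiableAt ℂ (fun Q => χ (γ (κ Q)) b) Q := (differentiableAt_pi.1 h) b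
    exact (((differentiable_entry i j) _).comp Q hb).differentiableWithinAt
  · obtain ⟨-, -, hκr, hT, ⟨⟨hfib, -, hlag, hrealQ⟩, -⟩, htr⟩ := hSsub hQ'
    obtain ⟨hfix, hμ⟩ := hrealQ (hκr Q' rfl)
    have hmem : ∀ b, χ (γ (κ (coeField Q'))) b ∈ Matrix.specialUnitaryGroup (Fin 2) ℂ := fun b => by
      refine mem_specialUnitaryGroup_of_theta_fixed ?_ (hχdet _ b)
      have h := hχθ (γ (κ (coeField Q'))) b
      rwa [hfix] at h
    let U' : GaugeField P 0 SU2 := fun b => ⟨χ (γ (κ (coeField Q'))) b, hmem b⟩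
    have hU' : χ (γ (κ (coeField Q'))) = coeField U' := funext fun b => rfl
    obtain ⟨hreg, hagree, hcritQ⟩ := htr U' Q' (Λ (κ (coeField Q'))) hU' rfl hfib hlag hμ
    exact ⟨U', fun b => rfl, hT U' Q' rfl hreg hagree hcritQ⟩

end

end Literature.MathematicalPhysics.QuantumFieldTheory.Balaban1983to89.B15Prop1CriticalChartFromIFTB

end
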